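import Literature.NumberTheory.Automorphic.BCDTModularityTwistInvarianceProofs
import Literature.NumberTheory.EllipticCurves.RootNumberTwistSemistableProofs
import Literature.NumberTheory.EllipticCurves.QuadraticTwistKroneckerLFunctionProofs
import Literature.NumberTheory.EllipticCurves.SzpiroLocalDataProofs
import HarnessLib

/-!
# The twist `E^{(p*)}` of a semistable modular elliptic curve by a good prime `p ≥ 5` is modular

A `…Proofs` companion (theorems only: no definition, no named fact, no instance; D-0026) of
`Literature.NumberTheory.Automorphic.BCDTModularity` /
`BCDTModularityTwistInvarianceProofs`, discharging the two curve-side hypotheses of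
`IsModular.of_LFunction_eq_twist` (`aₙ(W') = ψ(n) aₙ(W)` and `N_{W'} = N_W m²`) in the basic
unconditional case:

* `conductorNorm_quadraticTwist_pStar_of_squarefree` — for `W / ℚ` elliptic with SQUAREFREE
  conductor (semistable) and a prime `p ≥ 5`, `p ∤ N_W`, the twist `W' = W^{(p*)}`,
  `p* = (−1)^{(p−1)/2} p`, has conductor `N_{W'} = N_W p²`: away from `p` the reduction types of `W'`
  and `W` agree (`hasReductionAt_quadraticTwist_pStar_iff`: `p*` is a `v`-adic unit, `≡ 1 (mod 4)`),
  and both are good or multiplicative (`f_v ∈ {0, 1}`, `conductorExponent_eq_zero_iff_holds`,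
  `conductorExponent_eq_one_iff_holds`); at `p`, `W` is good (`p ∤ N_W`) so `W'` is additive
  (`hasAdditiveReductionAt_quadraticTwist_of_dvd` on a global minimal model,
  `hasGlobalMinimalModel_rat_holds`) with `f_p(W') = 2` (`p ≥ 5`:
  `conductorExponent_le_two_of_five_le_natGenerator_holds`, `two_le_conductorExponent_iff_holds`);
  assembled through `factorization_conductorNorm_holds` (Silverman, *ATAEC* IV.10.2, IV.10.4).
* `LFunction_quadraticTwist_pStar_apply_complex_of_not_dvd` — `aₙ(W') = (n/p) aₙ(W)` for ALL `n`
  (away from `p`: `LFunction_quadraticTwist_pStar_apply`; at the multiples of `p` both sides vanish,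
  `LFunction_apply_eq_zero_of_hasAdditiveReductionAt`).
* `IsModular.quadraticTwist_pStar_of_squarefree` — **if `W` is semistable and modular
  (`BCDT.IsModular W`) then `W^{(p*)}` is modular for every prime `p ≥ 5` with `p ∤ N_W`**, its newform
  being `f_W ⊗ (·/p) ∈ S₂(Γ₀(N_W p²))` (Atkin–Li; `IsModular.of_LFunction_eq_twist`).

Thus modularity of the semistable curves (Wiles 1995, Taylor–Wiles 1995) propagates, inside the
tree and unconditionally in the modular-forms half, to their twists by a single good prime `p ≥ 5` —
a family with one additive prime of quadratic-twist type (Diamond 1996 / Diamond–Kramer 1995 treat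
such curves by extending the lifting theorems instead).

## References

* [AtkinLi1978] A. O. L. Atkin, W.-C. W. Li, Invent. Math. 48 (1978), §3, Thm. 3.1.
* [Silverman1994] J. H. Silverman, *Advanced Topics in the Arithmetic of Elliptic Curves*, IV.10.2,
  IV.10.4 (conductor exponents).
* [SilvermanAEC2009] J. H. Silverman, *The Arithmetic of Elliptic Curves*, 2nd ed., VII.5 Prop. 5.1,
  X.2 (quadratic twists), X.5 Cor. 5.4.
-/

noncomputable section

open scoped MatrixGroups ModularForm Classical

open CongruenceSubgroup IsDedekindDomain IsDedekindDomain.HeightOneSpectrum NumberField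
  Rat.HeightOneSpectrum

namespace Literature.NumberTheory.Automorphic.BCDT

open EllipticCurves.ModularForms WeierstrassCurve

variable (W : WeierstrassCurve ℚ) [W.IsElliptic]

/-- The place of `ℤ` with a given generator is `primesEquiv.symm` of it. [folklore] -/
theorem eq_primesEquiv_symm_of_natGenerator_eq (v : HeightOneSpectrum ℤ) {p : ℕ} (hp : p.Prime)
    (hv : natGenerator v = p) : v = (primesEquiv (R := ℤ)).symm ⟨p, hp⟩ := by
  apply (primesEquiv (R := ℤ)).injective
  rw [Equiv.apply_symm_apply]
  exact Subtype.ext hv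

/-- **`W^{(p*)}` is additive at `p` when `W` is good at `p`** (`p` odd): on a global minimal model
(`hasGlobalMinimalModel_rat_holds`) this is `hasAdditiveReductionAt_quadraticTwist_of_dvd`
(Silverman, *AEC* VII.5 Prop. 5.1(c): `v(Δ^{(p*)}) = 6`, `v(c₄^{(p*)}) ≥ 2`), transported by the
isomorphism invariance of the reduction type (`hasAdditiveReductionAt_smul_iff_holds`,
`quadraticTwist_smul`). [cite: SilvermanAEC2009, VII.5 Prop. 5.1(c)] -/
theorem hasAdditiveReductionAt_quadraticTwist_pStar_of_hasGoodReductionAt {p : ℕ} (hp : p.Prime)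
    (hp2 : p ≠ 2) {v : HeightOneSpectrum (𝓞 ℚ)} (hv : (primesEquiv v : ℕ) = p)
    (hgood : W.HasGoodReductionAt v) :
    (W.quadraticTwist (((-1 : ℤ) ^ (p / 2) * p : ℤ) : ℚ)).HasAdditiveReductionAt v := by
  set d : ℤ := (-1 : ℤ) ^ (p / 2) * p with hd
  have hdZ : d ≠ 0 := mul_ne_zero (pow_ne_zero _ (by norm_num)) (by exact_mod_cast hp.ne_zero)
  have hd0 : (d : ℚ) ≠ 0 := by exact_mod_cast hdZ
  haveI : (W.quadraticTwist (d : ℚ)).IsElliptic := W.isElliptic_quadraticTwist hd0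
  obtain ⟨C, hC⟩ := hasGlobalMinimalModel_rat_holds W
  haveI := hC
  have hgood' : (C • W).HasGoodReductionAt v := (hasGoodReductionAt_smul_iff_holds v W C).mpr hgood
  have hv2 : (primesEquiv v : ℕ) ≠ 2 := by rwa [hv]
  have h1 : ((primesEquiv v : ℕ) : ℤ) ∣ d := by rw [hv, hd]; exact dvd_mul_left _ _
  have h2 : ¬ ((primesEquiv v : ℕ) : ℤ) ^ 2 ∣ d := by
    rw [hv, hd]
    rintro ⟨c, hc⟩
    have habs := congrArg Int.natAbs hc
    rw [Int.natAbs_mul, Int.natAbs_pow, Int.natAbs_neg, Int.natAbs_one, one_pow, one_mul,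
      Int.natAbs_mul, Int.natAbs_pow, Int.natAbs_natCast] at habs
    have hc0 : c.natAbs ≠ 0 := by
      intro h0
      rw [h0, mul_zero] at habs
      exact hp.ne_zero habs
    have : p ^ 2 ≤ p := by
      calc p ^ 2 ≤ p ^ 2 * c.natAbs := Nat.le_mul_of_pos_right _ (Nat.pos_of_ne_zero hc0)
        _ = p := habs.symm
    nlinarith [hp.two_le]
  have hadd := (C • W).hasAdditiveReductionAt_quadraticTwist_of_dvd v hv2 hdZ h1 h2 hgood'
  rw [quadraticTwist_smul] at hadd
  exact (hasAdditiveReductionAt_smul_iff_holds v (W.quadraticTwist (d : ℚ)) _).mp hadd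

/-- **Good reduction away from the conductor** (over the places of `𝓞 ℚ`): `p ∤ N_W ⇒` good
reduction at the place over `p` (`f_p = 0`, `factorization_conductorNorm_holds`,
`conductorExponent_eq_zero_iff_holds`; transport `hasGoodReductionAtPrime_iff_hasGoodReductionAt_holds`,
`hasGoodReductionAtPrime_iff_hasGoodReductionAt_ringOfIntegers`).  Same statement as
`hasGoodReductionAt_of_not_dvd_conductorNorm` of `NonvanishingTwistsWaldspurgerOfHoffsteinLuo`, repeated
to keep this file's imports light. [cite: Silverman1994, IV.10.2(a)] -/
theorem hasGoodReductionAt_ringOfIntegers_of_not_dvd_conductorNorm (v : HeightOneSpectrum (𝓞 ℚ))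
    (hv : ¬ (primesEquiv v : ℕ) ∣ W.conductorNorm ℤ) : W.HasGoodReductionAt v := by
  set p : Nat.Primes := primesEquiv v with hp
  haveI := Fact.mk p.2
  set vZ : HeightOneSpectrum ℤ := (primesEquiv (R := ℤ)).symm p with hvZ
  have hgen : natGenerator vZ = p := Literature.NumberTheory.EllipticCurves.Rat.natGenerator_primesEquiv_symm p
  have hf : W.conductorExponent vZ = 0 := by
    rw [← factorization_conductorNorm_holds W vZ, hgen]
    exact Nat.factorization_eq_zero_of_not_dvd hv
  have hgZ : W.HasGoodReductionAt vZ := (conductorExponent_eq_zero_iff_holds vZ W).mp hf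
  have hgP : W.HasGoodReductionAtPrime p :=
    (W.hasGoodReductionAtPrime_iff_hasGoodReductionAt_holds p).mpr hgZ
  exact (hasGoodReductionAtPrime_iff_hasGoodReductionAt_ringOfIntegers v W).mp hgP

/-- **`aₙ(W^{(p*)}) = (n/p) aₙ(W)` for all `n`** when `p ∤ N_W` (`p` odd): away from `p` this is
`LFunction_quadraticTwist_pStar_apply` (Silverman, *AEC* X.2, Exercise 10.16), and for `p ∣ n` both
sides vanish — `W^{(p*)}` is additive at `p` (`LFunction_apply_eq_zero_of_hasAdditiveReductionAt`) and
`(n/p) = 0`.  Stated in `ℂ` with the Dirichlet character `(·/p) ⊗ ℂ`. [cite: SilvermanAEC2009, X.2 Exercise 10.16] -/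
theorem LFunction_quadraticTwist_pStar_apply_complex_of_not_dvd {p : ℕ} [Fact p.Prime] (hp2 : p ≠ 2)
    (hpN : ¬ p ∣ W.conductorNorm ℤ) (n : ℕ) :
    (((W.quadraticTwist (((-1 : ℤ) ^ (p / 2) * p : ℤ) : ℚ)).LFunction n : ℤ) : ℂ) =
      (quadraticChar (ZMod p)).ringHomComp (Int.castRingHom ℂ) n * (W.LFunction n : ℂ) := by
  have hp : p.Prime := Fact.out
  rw [quadraticChar_ringHomComp_apply_natCast p n]
  by_cases hpn : p ∣ n
  · obtain ⟨v, hv⟩ : ∃ v : HeightOneSpectrum (𝓞 ℚ), (primesEquiv v : ℕ) = p :=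
      ⟨primesEquiv.symm ⟨p, hp⟩, by rw [Equiv.apply_symm_apply]⟩
    have hgood : W.HasGoodReductionAt v :=
      hasGoodReductionAt_ringOfIntegers_of_not_dvd_conductorNorm W v (by rwa [hv])
    have hadd := hasAdditiveReductionAt_quadraticTwist_pStar_of_hasGoodReductionAt W hp hp2 hv hgood
    have hdZ : ((-1 : ℤ) ^ (p / 2) * p : ℤ) ≠ 0 :=
      mul_ne_zero (pow_ne_zero _ (by norm_num)) (by exact_mod_cast hp.ne_zero)
    haveI : (W.quadraticTwist (((-1 : ℤ) ^ (p / 2) * p : ℤ) : ℚ)).IsElliptic :=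
      W.isElliptic_quadraticTwist (by exact_mod_cast hdZ)
    have h0 : legendreSym p n = 0 :=
      (legendreSym.eq_zero_iff p n).mpr (by exact_mod_cast (ZMod.natCast_eq_zero_iff n p).mpr hpn)
    rw [WeierstrassCurve.LFunction_apply_eq_zero_of_hasAdditiveReductionAt _ hv hadd hpn, h0]
    push_cast
    ring
  · rw [W.LFunction_quadraticTwist_pStar_apply hp2 hpn]
    push_cast
    rfl

/-- **Conductor of `W^{(p*)}` for `W` semistable and `p ≥ 5` good**: `N_{W^{(p*)}} = N_W p²`
(Silverman, *ATAEC* IV.10.2, IV.10.4: `f_v(W') = f_v(W) ∈ {0, 1}` for `v ∤ p`, where the reduction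
types agree, `hasReductionAt_quadraticTwist_pStar_iff`; `f_p(W') = 2`, additive and tame).
[cite: Silverman1994, IV.10.2 and IV.10.4] -/
theorem conductorNorm_quadraticTwist_pStar_of_squarefree (hsq : Squarefree (W.conductorNorm ℤ))
    {p : ℕ} (hp : p.Prime) (hp5 : 5 ≤ p) (hpN : ¬ p ∣ W.conductorNorm ℤ) :
    (W.quadraticTwist (((-1 : ℤ) ^ (p / 2) * p : ℤ) : ℚ)).conductorNorm ℤ = W.conductorNorm ℤ * p ^ 2 := by
  haveI := Fact.mk hp
  have hp2 : p ≠ 2 := by omega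
  set d : ℤ := (-1 : ℤ) ^ (p / 2) * p with hd
  have hdZ : d ≠ 0 := mul_ne_zero (pow_ne_zero _ (by norm_num)) (by exact_mod_cast hp.ne_zero)
  set W' := W.quadraticTwist (d : ℚ) with hW'
  haveI : W'.IsElliptic := W.isElliptic_quadraticTwist (by exact_mod_cast hdZ)
  have hN0 : W.conductorNorm ℤ ≠ 0 := (W.conductorNorm_pos_holds).ne'
  have hN'0 : W'.conductorNorm ℤ ≠ 0 := (W'.conductorNorm_pos_holds).ne'
  -- the conductor exponents, place by place
  have hexp : ∀ v : HeightOneSpectrum ℤ,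
      W'.conductorExponent v = W.conductorExponent v + (if natGenerator v = p then 2 else 0) := by
    intro v
    by_cases hv : natGenerator v = p
    · -- at `p`: `f_p(W) = 0`, `f_p(W') = 2`
      rw [if_pos hv]
      have hfW : W.conductorExponent v = 0 := by
        rw [← factorization_conductorNorm_holds W v, hv]
        exact Nat.factorization_eq_zero_of_not_dvd hpN
      obtain ⟨vO, hvO⟩ : ∃ vO : HeightOneSpectrum (𝓞 ℚ), (primesEquiv vO : ℕ) = p :=
        ⟨primesEquiv.symm ⟨p, hp⟩, by rw [Equiv.apply_symm_apply]⟩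
      have hgood : W.HasGoodReductionAt vO :=
        hasGoodReductionAt_ringOfIntegers_of_not_dvd_conductorNorm W vO (by rwa [hvO])
      have haddO := hasAdditiveReductionAt_quadraticTwist_pStar_of_hasGoodReductionAt W hp hp2 hvO hgood
      have hvO' : vO = (primesEquiv (R := 𝓞 ℚ)).symm ⟨p, hp⟩ := by
        apply (primesEquiv (R := 𝓞 ℚ)).injective
        rw [Equiv.apply_symm_apply]
        exact Subtype.ext hvO
      have hvZ : v = (primesEquiv (R := ℤ)).symm ⟨p, hp⟩ := eq_primesEquiv_symm_of_natGenerator_eq v hp hv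
      have hadd : W'.HasAdditiveReductionAt v := by
        rw [hvZ, W'.hasAdditiveReductionAt_int_iff_ringOfIntegers ⟨p, hp⟩, ← hvO']
        exact haddO
      have h2le : 2 ≤ W'.conductorExponent v := (two_le_conductorExponent_iff_holds v W').mpr hadd
      have hle2 : W'.conductorExponent v ≤ 2 :=
        W'.conductorExponent_le_two_of_five_le_natGenerator_holds v (by rw [hv]; exact hp5)
      omega
    · -- away from `p`: the reduction types agree and are good or multiplicative
      rw [if_neg hv, add_zero]
      obtain ⟨hg, hm, _⟩ := W.hasReductionAt_quadraticTwist_pStar_iff hp2 v hv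
      have hna := W.not_hasAdditiveReductionAt_of_squarefree_conductorNorm hsq v
      rcases W.hasGoodReductionAt_or_hasMultiplicativeReductionAt_or_hasAdditiveReductionAt v with
        hgood | hmult | hadd
      · rw [(conductorExponent_eq_zero_iff_holds v W).mpr hgood,
          (conductorExponent_eq_zero_iff_holds v W').mpr (hg.mpr hgood)]
      · rw [(conductorExponent_eq_one_iff_holds v W).mpr hmult,
          (conductorExponent_eq_one_iff_holds v W').mpr (hm.mpr hmult)]
      · exact absurd hadd hna
  -- compare factorisations
  refine Nat.eq_of_factorization_eq hN'0 (mul_ne_zero hN0 (pow_ne_zero 2 hp.ne_zero)) fun ℓ ↦ ?_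
  rw [Nat.factorization_mul hN0 (pow_ne_zero 2 hp.ne_zero), Finsupp.add_apply, Nat.factorization_pow,
    Finsupp.smul_apply, smul_eq_mul, hp.factorization, Finsupp.single_apply]
  by_cases hℓ : ℓ.Prime
  · set v : HeightOneSpectrum ℤ := (primesEquiv (R := ℤ)).symm ⟨ℓ, hℓ⟩ with hvdef
    have hgen : natGenerator v = ℓ := Literature.NumberTheory.EllipticCurves.Rat.natGenerator_primesEquiv_symm ⟨ℓ, hℓ⟩
    rw [← hgen, factorization_conductorNorm_holds W' v, factorization_conductorNorm_holds W v, hexp v, hgen]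
    by_cases hℓp : ℓ = p
    · subst hℓp; simp
    · rw [if_neg hℓp, if_neg (Ne.symm hℓp)]
      ring
  · rw [Nat.factorization_eq_zero_of_not_prime _ hℓ, Nat.factorization_eq_zero_of_not_prime _ hℓ]
    have : p ≠ ℓ := fun h ↦ hℓ (h ▸ hp)
    rw [if_neg this]
    ring

/-- **The twist `E^{(p*)}` of a semistable modular curve by a good prime `p ≥ 5` is modular.**  For
`W / ℚ` elliptic with squarefree conductor, modular (`IsModular W`), and a prime `p ≥ 5` with
`p ∤ N_W`, the quadratic twist `W^{(p*)}`, `p* = (−1)^{(p−1)/2} p`, is modular: by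
`IsModular.of_LFunction_eq_twist` with `ψ = (·/p)` (primitive quadratic of conductor `p`, prime to
`N_W`), `aₙ(W^{(p*)}) = (n/p) aₙ(W)` (`LFunction_quadraticTwist_pStar_apply_complex_of_not_dvd`) and
`N_{W^{(p*)}} = N_W p²` (`conductorNorm_quadraticTwist_pStar_of_squarefree`); its newform is
`f_W ⊗ (·/p)`, a newform of level `N_W p²` by Atkin–Li. [cite: AtkinLi1978, §3, Thm. 3.1] -/
theorem IsModular.quadraticTwist_pStar_of_squarefree [NeZero (W.conductorNorm ℤ)] (hW : IsModular W)
    (hsq : Squarefree (W.conductorNorm ℤ)) {p : ℕ} (hp : p.Prime) (hp5 : 5 ≤ p)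
    (hpN : ¬ p ∣ W.conductorNorm ℤ)
    [NeZero ((W.quadraticTwist (((-1 : ℤ) ^ (p / 2) * p : ℤ) : ℚ)).conductorNorm ℤ)] :
    IsModular (W.quadraticTwist (((-1 : ℤ) ^ (p / 2) * p : ℤ) : ℚ)) := by
  haveI := Fact.mk hp
  haveI : NeZero p := ⟨hp.ne_zero⟩
  have hp2 : p ≠ 2 := by omega
  have hNm : (W.conductorNorm ℤ).Coprime p := (hp.coprime_iff_not_dvd.mpr hpN).symm
  exact IsModular.of_LFunction_eq_twist hW (isQuadratic_quadraticChar_ringHomComp p)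
    (isPrimitive_quadraticChar_ringHomComp p hp2) hp.isPrimePow hNm _
    (LFunction_quadraticTwist_pStar_apply_complex_of_not_dvd W hp2 hpN)
    (conductorNorm_quadraticTwist_pStar_of_squarefree W hsq hp hp5 hpN)

end Literature.NumberTheory.Automorphic.BCDT

end
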